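import Literature.MathematicalPhysics.QuantumFieldTheory.Federbush1986.ObservationCriterion
import Literature.MathematicalPhysics.QuantumFieldTheory.Federbush1986.PeelingEstimate

/-!
# Federbush [F3] §5.3 2) p. 303 made QUANTITATIVE under the exact criterion: whenever the based plaquette words GENERATE, the bond
# variables are LIPSCHITZ in the plaquette variables (bondwise constants = word lengths), for every group with a bi-invariant metric

statement-level skeleton of published theorems with citation tags; proofs where landed; nothing here is a claim about the Yang–Mills mass gap

SOURCES. [Federbush1987PhaseCellIII] P. Federbush, *A phase cell approach to Yang–Mills theory III. Local stability, modified
renormalization group transformation*, Commun. Math. Phys. **110** (1987) 293–309: §5.1 p. 299 *«We define |g| = d(ε, g). … Lemma 5.1.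
|g₁g₂| ≦ |g₁| + |g₂| (5.2) … Lemma 5.3. |g| = |g⁻¹| (5.6) … by invariance of the metric»*; §5.3 2) p. 303 *«Observation. In a simply
connected lattice, if the bonds in a maximal tree are assigned the identity as a choice of gauge, then the bond variables are uniquely
determined by the plaquette variables.»*; §5.2 p. 302 *«By the inverse function theorem we have for A_{∂p_i} small enough (depending
on N), |A_{b_α} − Σ_i N_{αi}A_{∂p_i}| < cΣ|A_{∂p_i}|². (5.24)  This estimate will enable us to control all corrections to steps in
the small field proof.»*

CITATION HEADER (lean-in-tree rule).  lit-balaban cell (HOME `run/shared/lean/pub/lit-balaban/`), Phase-2 proof seat p26 (gen 12;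
free-target protocol G.5-34(d)), SKELETON row **F3.Eq5.26-5.40** (§5.3, head `absent`; owner r17, referee ref-5).  Joins this gen's
`ObservationCriterion` (p316915: `Generated ⇔` the Observation for every group) to gen 11's `PeelingEstimate` (p315145/p315858: in a
PEELABLE gauge the determination is Lipschitz, constant `(3^{rank+1} − 1)/2`): the Lipschitz property needs only GENERATION.

WHAT IS PROVED (every `ℤ^d`; `P`, `Λ`, `T` arbitrary; `G` any group with a bi-invariant metric — [F3] §5.1's setting).
* §1 **`exists_lipschitz_of_mem_closure`**: every element `x` of the subgroup generated by the based plaquette words has a WORD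
  LENGTH `C` such that, for all tree-gauged `u, u′` whose plaquette variables are within `α` of each other on `P`,
  `d((lift u) x, (lift u′) x) ≦ C·α` (Lemmas 5.1/5.3: `d(ab, a′b′) ≦ d(a,a′) + d(b,b′)`, `d(a⁻¹, a′⁻¹) = d(a, a′)`); hence
  **`Generated.exists_lipschitz`**: under generation every bond of `Λ` has a constant `C_b` with `d(u_b, u′_b) ≦ C_b·α` — «uniquely
  determined», Lipschitz-continuously, the group-level global counterpart of (5.24) WITHOUT a peeling; small-field form
  `Generated.exists_absG_le` (`|u_b| ≦ C_b · max_p |g_{∂p}|`); a choice of constants `Generated.exists_lipschitzConst`.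
* §2 conversely a bondwise Lipschitz determination is a determination (`observationFor_of_lipschitz`, `α = 0`), so by p316915 the
  Lipschitz Observation for every metric group is again EQUIVALENT to generation as far as groups in `Type` with the discrete
  bi-invariant metric are concerned (not formalised: only the two implications are).
* §3 instances: the comb of a box (`exists_lipschitz_comb`, an inexplicit-constant shadow of `PeelingEstimate.dist_le_height_mul_of_combGauge`).

HONEST SCOPE.  A located mechanism, not a display of [F3]; constants are word lengths (inexplicit `∃ C`), the explicit constants of
the comb / peelable gauges remain those of `PeelingEstimate`.  No definitions; every declaration is a theorem; no `sorry`, axioms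
standard.  Unit `lit-balaban-p26` (literature-prover-lit-balaban-p26-g12-0).
-/

namespace Literature.MathematicalPhysics.QuantumFieldTheory.Federbush1986

namespace ObservationCriterion

open LatticeContour SimplyConnectedBox CombGaugeObservation PeelingObservation

variable {d : ℕ}

section Metric

variable {G : Type*} [Group G] [MetricSpace G] [IsIsometricSMul G G] [IsIsometricSMul Gᵐᵒᵖ G]
variable {P : Set (LatticeContour.Plaq d)} {Λ T : Set (Bond d)}

/-! ## §1 Word length ⇒ Lipschitz constant -/

/-- **Word length is a Lipschitz constant.**  Every element of the subgroup generated by the based plaquette words admits `C : ℕ` with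
`d((lift u) x, (lift u′) x) ≦ C·α` for all tree-gauged `u, u′` whose plaquette variables are `α`-close on `P` (induction on the
closure: a plaquette word costs `1`, the unit `0`, products add, inverses cost the same — Lemmas 5.1 and 5.3).
[cite: Federbush1987PhaseCellIII, Lemmas 5.1, 5.3 (5.2), (5.6) p. 299; §5.3 2) Observation p. 303] -/
theorem exists_lipschitz_of_mem_closure {x : FreeGroup (Bond d)} (hx : x ∈ Subgroup.closure (plaqWord T '' P)) :
    ∃ C : ℕ, ∀ (u u' : Bond d → G), (∀ b ∈ T, u b = 1) → (∀ b ∈ T, u' b = 1) → ∀ α : ℝ,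
      (∀ p ∈ P, dist (wordHol u (plaqLoop p.1 p.2.1 p.2.2)) (wordHol u' (plaqLoop p.1 p.2.1 p.2.2)) ≤ α) →
      dist (FreeGroup.lift u x) (FreeGroup.lift u' x) ≤ C * α := by
  induction hx using Subgroup.closure_induction with
  | mem x hx =>
    obtain ⟨p, hp, rfl⟩ := hx
    refine ⟨1, fun u u' hg hg' α hα => ?_⟩
    rw [lift_plaqWord u hg, lift_plaqWord u' hg', Nat.cast_one, one_mul]
    exact hα p hp
  | one => exact ⟨0, fun u u' _ _ α _ => by simp⟩
  | mul x y _ _ ihx ihy =>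
    obtain ⟨C₁, h₁⟩ := ihx
    obtain ⟨C₂, h₂⟩ := ihy
    refine ⟨C₁ + C₂, fun u u' hg hg' α hα => ?_⟩
    rw [map_mul, map_mul, Nat.cast_add, add_mul]
    exact (dist_mul_mul_le' _ _ _ _).trans (add_le_add (h₁ u u' hg hg' α hα) (h₂ u u' hg hg' α hα))
  | inv x _ ih =>
    obtain ⟨C, hC⟩ := ih
    refine ⟨C, fun u u' hg hg' α hα => ?_⟩
    rw [map_inv, map_inv, dist_inv_inv]
    exact hC u u' hg hg' α hα

/-- **Generation ⇒ the Observation is LIPSCHITZ, every group with a bi-invariant metric**: for every bond `b` of `Λ` there is a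
constant `C_b` (a word length) with `d(u_b, u′_b) ≦ C_b·α` whenever `u, u′` are `ε` on `T` and their plaquette variables are within
`α` on `P` — the global, group-level counterpart of (5.24) «this estimate will enable us to control all corrections», with no
peeling assumed. [cite: Federbush1987PhaseCellIII, §5.3 2) Observation p. 303, (5.24) p. 302] -/
theorem Generated.exists_lipschitz (h : Generated P Λ T) {b : Bond d} (hb : b ∈ Λ) :
    ∃ C : ℕ, ∀ (u u' : Bond d → G), (∀ c ∈ T, u c = 1) → (∀ c ∈ T, u' c = 1) → ∀ α : ℝ,
      (∀ p ∈ P, dist (wordHol u (plaqLoop p.1 p.2.1 p.2.2)) (wordHol u' (plaqLoop p.1 p.2.1 p.2.2)) ≤ α) →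
      dist (u b) (u' b) ≤ C * α := by
  obtain ⟨C, hC⟩ := exists_lipschitz_of_mem_closure (G := G) (h b hb)
  refine ⟨C, fun u u' hg hg' α hα => ?_⟩
  have h1 := hC u u' hg hg' α hα
  rwa [lift_univ u hg, lift_univ u' hg'] at h1

/-- **Small-field form**: under generation, `ε` on `T` and `|g_{∂p}| ≦ α` on `P` give `|u_b| ≦ C_b·α` on `Λ`.
[cite: Federbush1987PhaseCellIII, §5.3 2) Observation p. 303, §5.1 p. 299] -/
theorem Generated.exists_absG_le (h : Generated P Λ T) {b : Bond d} (hb : b ∈ Λ) :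
    ∃ C : ℕ, ∀ (u : Bond d → G), (∀ c ∈ T, u c = 1) → ∀ α : ℝ,
      (∀ p ∈ P, absG (wordHol u (plaqLoop p.1 p.2.1 p.2.2)) ≤ α) → absG (u b) ≤ C * α := by
  obtain ⟨C, hC⟩ := h.exists_lipschitz (G := G) hb
  refine ⟨C, fun u hg α hα => ?_⟩
  have h1 := hC (fun _ => 1) u (fun _ _ => rfl) hg α fun p hp => by
    rw [wordHol_eq_one_of_forall _ fun _ _ => rfl]; exact hα p hp
  simpa [absG] using h1

/-- A choice of the bondwise constants as a function on bonds. [cite: Federbush1987PhaseCellIII, §5.3 2) Observation p. 303] -/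
theorem Generated.exists_lipschitzConst (h : Generated P Λ T) :
    ∃ C : Bond d → ℕ, ∀ b ∈ Λ, ∀ (u u' : Bond d → G), (∀ c ∈ T, u c = 1) → (∀ c ∈ T, u' c = 1) → ∀ α : ℝ,
      (∀ p ∈ P, dist (wordHol u (plaqLoop p.1 p.2.1 p.2.2)) (wordHol u' (plaqLoop p.1 p.2.1 p.2.2)) ≤ α) →
      dist (u b) (u' b) ≤ C b * α := by
  classical
  refine ⟨fun b => if hb : b ∈ Λ then (h.exists_lipschitz (G := G) hb).choose else 0, fun b hb u u' hg hg' α hα => ?_⟩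
  simp only [dif_pos hb]
  exact (h.exists_lipschitz (G := G) hb).choose_spec u u' hg hg' α hα

/-! ## §2 A Lipschitz determination is a determination -/

omit [IsIsometricSMul G G] [IsIsometricSMul Gᵐᵒᵖ G] in
/-- Conversely, bondwise Lipschitz bounds (for the one value `α = 0`) give the Observation for `G`.
[cite: Federbush1987PhaseCellIII, §5.3 2) Observation p. 303] -/
theorem observationFor_of_lipschitz
    (h : ∀ b ∈ Λ, ∃ C : ℝ, ∀ (u u' : Bond d → G), (∀ c ∈ T, u c = 1) → (∀ c ∈ T, u' c = 1) →
      (∀ p ∈ P, dist (wordHol u (plaqLoop p.1 p.2.1 p.2.2)) (wordHol u' (plaqLoop p.1 p.2.1 p.2.2)) ≤ 0) →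
      dist (u b) (u' b) ≤ C * 0) :
    ObservationFor G P Λ T := by
  intro u u' hg hg' hplaq b hb
  obtain ⟨C, hC⟩ := h b hb
  have h1 := hC u u' hg hg' fun p hp => by rw [hplaq p hp, dist_self]
  rw [mul_zero] at h1
  exact dist_le_zero.1 h1

/-! ## §3 Instance: the comb of a box -/

/-- In the comb gauge of a box the bond variables are Lipschitz in the plaquette variables for every metric group — here with an
inexplicit constant from generation alone (the explicit `height(b)·α` is `PeelingEstimate.dist_le_height_mul_of_combGauge`).
[cite: Federbush1987PhaseCellIII, §5.3 2)–3) Observation p. 303] -/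
theorem exists_lipschitz_comb (lo hi : Site d) {b : Bond d} (hb : b ∈ boxBonds lo hi) :
    ∃ C : ℕ, ∀ (u u' : Bond d → G), (∀ c ∈ combTree lo hi, u c = 1) → (∀ c ∈ combTree lo hi, u' c = 1) → ∀ α : ℝ,
      (∀ p ∈ boxPlaq lo hi, dist (wordHol u (plaqLoop p.1 p.2.1 p.2.2)) (wordHol u' (plaqLoop p.1 p.2.1 p.2.2)) ≤ α) →
      dist (u b) (u' b) ≤ C * α :=
  (generated_comb lo hi).exists_lipschitz hb

end Metric

end ObservationCriterion

end Literature.MathematicalPhysics.QuantumFieldTheory.Federbush1986
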